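import Summits.QuantumFields.YangMills.Theorems.BalabanUVNodesN19LipBracketTubeLine

/-!
# BalabanUVNodes ∕ N19 — companion of `BalabanUVNodesN19LipBracketTubeLine`: U(1) NON-VACUITY of the tube-line binders
# (cell `pub-ymgap`, HUMAN RULING D-0062 Track A, node N19 = NE7, R134 seat dag-n19-c g3, strategy s1″; split off under the
# 400-line rule; count-neutral)

HONEST FRAMING.  As in the main file: one fixed finite four-torus, rung (B)+1 — NOT infinite volume, NOT OS on ℝ⁴, NOT a
mass gap, NOT the Clay problem; NE7 NOT PRINTED and NOT proved; N19 NOT discharged; THEOREMS ONLY, 0 `def`, 0 `sorry`,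
standard axioms; filed `--supports` the K3′ item `SpineGivenEndpointR12` AS A HELPER; NOT a discharge claim.  TOY DATA, no
relation to Bałaban's objects.

WHAT THIS FILE PROVES.
* `toy_emb_reach` — on `T4TowerRateComposition.toyCarriers` (backgrounds `ℝ`, gauge `|U − U′|`) the U(1) chart
  `emb U = exp(iU) : Unit → ℂ` obeys the reach convention of `N19LipBracketTubeLine.pairDisc_of_tubeLine` with the sup-norm
  size: `U′` is reached from `U` by the generator `K ≡ i(U′ − U)` of norm `|U − U′|`.
* `toy_tube_mem_annulus` — the (1.13) tube of half-width `ϱ` about `exp(iU)` lies in the ANNULUS `e^{−ϱ} < |V| < e^{ϱ}`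
  (the toy's analyticity space).
* `toy_hol`, `toy_bound`∕`toy_bd`, `toy_real` — the toy extension `Ecx V = E₀e^{−ϱ}·(V + V⁻¹)∕2` is holomorphic on the
  annulus, bounded by `E₀` there, and EQUAL to this seat's g2 toy functional `E₀e^{−ϱ}cos U`
  (`N19LipBracketTubeWitness.toy_pairDisc`) on the circle.
* **`toy_pairDiscs_of_tubeLine`** — NON-VACUITY of the binder set of `N19LipBracketTubeLine.pairDisc_of_tubeLine_norm`
  (`𝔸 = ℂ`, `ι = Unit`, chart `exp(iU)`, space = the annulus, the extension above): every pair of toy backgrounds closer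
  than `ϱ` gets its pair disc THROUGH the tube line (it is g2's toy disc `z ↦ E₀e^{−ϱ}cos(U + cz)`, now PRODUCED, not
  posited); **`toy_decayBound_of_tubeLine`** — the real bound with `E₀` through `decayBound_of_tubeLine`.  Feeding both to
  `N19LipBracketTube.lipBackground_of_pairDisc` returns the conclusion of the landed `N19LipBracketTubeWitness.toy_pairDisc`
  (`LipBackground … (2E₀∕ϱ)`; not restated here).

CITATION HEADER (LOCATIONS only, as in the main file; no decl below carries a cite tag).  [Balaban1987RG1] CMP **109**
(1987) (1.13) p. 262, (1.18) p. 263; [Balaban1988Convergent] CMP **119** (1988) (2.27)(ii)(iv) p. 259.  Mathlib: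
`Complex.exp_eq_exp_ℂ`, `Complex.norm_exp`, `Complex.two_cos`, `differentiableAt_apply`, `DifferentiableAt.inv`.
-/

open Metric Set NormedSpace

namespace Summit.QuantumFields.YangMills.BalabanUVNodes.N19LipBracketTubeLineWitness

open Literature.MathematicalPhysics.QuantumFieldTheory.Balaban1983to89
open T4OutputRate (Carriers Functional LipBackground)
open T4TowerRateComposition (toyCarriers)
open N19LipBracketTubeLine (lipBackground_of_tubeLine)

/-- `NormedSpace.exp` on `ℂ` is `Complex.exp` (Mathlib `Complex.exp_eq_exp_ℂ`, pointwise). [folklore] -/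
theorem exp_eq_cexp (z : ℂ) : exp z = Complex.exp z := (congr_fun Complex.exp_eq_exp_ℂ z).symm

/-- The U(1) chart: `exp(iU′) = exp(i(U′ − U))·exp(iU)`. [folklore] -/
theorem toy_emb_mul (U U' : ℝ) :
    exp (((U' - U : ℝ) : ℂ) * Complex.I) * exp ((U : ℂ) * Complex.I) = exp ((U' : ℂ) * Complex.I) := by
  rw [exp_eq_cexp, exp_eq_cexp, exp_eq_cexp, ← Complex.exp_add]
  congr 1
  push_cast
  ring

/-- **REACH CONVENTION FOR THE U(1) CHART** on `toyCarriers` (gauge `|U − U′|`): the generator `K ≡ i(U′ − U)` has sup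
norm `|U − U′|` and carries `exp(iU)` to `exp(iU′)`. [folklore] -/
theorem toy_emb_reach (U U' : ℝ) :
    ∃ K : Unit → ℂ, ‖K‖ ≤ |U - U'| ∧
      (fun _ : Unit => exp ((U' : ℂ) * Complex.I)) = fun b => exp (K b) * exp ((U : ℂ) * Complex.I) := by
  refine ⟨fun _ => ((U' - U : ℝ) : ℂ) * Complex.I, ?_, ?_⟩
  · rw [pi_norm_const, norm_mul, Complex.norm_I, mul_one, Complex.norm_real, Real.norm_eq_abs, abs_sub_comm]
  · funext b
    rw [toy_emb_mul]

/-- **THE TUBE LIES IN THE ANNULUS**: for `‖K‖ < ϱ`, `e^{−ϱ} < ‖exp(K b)·exp(iU)‖ = e^{Re K b} < e^{ϱ}`. [folklore] -/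
theorem toy_tube_mem_annulus {ϱ : ℝ} (U : ℝ) {K : Unit → ℂ} (hK : ‖K‖ < ϱ) (b : Unit) :
    Real.exp (-ϱ) < ‖exp (K b) * exp ((U : ℂ) * Complex.I)‖ ∧
      ‖exp (K b) * exp ((U : ℂ) * Complex.I)‖ < Real.exp ϱ := by
  have hKb : ‖K b‖ < ϱ := (norm_le_pi_norm K b).trans_lt hK
  have hre : |(K b).re| < ϱ := (Complex.abs_re_le_norm (K b)).trans_lt hKb
  rw [exp_eq_cexp, exp_eq_cexp, norm_mul, Complex.norm_exp_ofReal_mul_I, mul_one, Complex.norm_exp]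
  exact ⟨Real.exp_lt_exp.2 (abs_lt.1 hre).1, Real.exp_lt_exp.2 (abs_lt.1 hre).2⟩

/-- On the annulus the toy extension `c·(V + V⁻¹)∕2` is bounded by `c·e^{ϱ}` (`c ≥ 0`). [folklore] -/
theorem toy_bound {ϱ c : ℝ} (hc : 0 ≤ c) {v : ℂ} (hlo : Real.exp (-ϱ) < ‖v‖) (hhi : ‖v‖ < Real.exp ϱ) :
    ‖(c : ℂ) * ((v + v⁻¹) / 2)‖ ≤ c * Real.exp ϱ := by
  have hinv : ‖v⁻¹‖ ≤ Real.exp ϱ := by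
    rw [norm_inv]
    have h := inv_anti₀ (Real.exp_pos (-ϱ)) hlo.le
    rwa [Real.exp_neg, inv_inv] at h
  have h2 : ‖(v + v⁻¹) / 2‖ ≤ Real.exp ϱ := by
    rw [norm_div, Complex.norm_ofNat]
    calc ‖v + v⁻¹‖ / 2 ≤ (‖v‖ + ‖v⁻¹‖) / 2 := by gcongr; exact norm_add_le _ _
      _ ≤ (Real.exp ϱ + Real.exp ϱ) / 2 := by gcongr
      _ = Real.exp ϱ := by ring
  rw [norm_mul, Complex.norm_real, Real.norm_eq_abs, abs_of_nonneg hc]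
  exact mul_le_mul_of_nonneg_left h2 hc

/-- On the circle the toy extension is g2's toy functional: `c·(exp(iU) + exp(iU)⁻¹)∕2 = c·cos U`. [folklore] -/
theorem toy_real (c U : ℝ) :
    (c : ℂ) * ((exp ((U : ℂ) * Complex.I) + (exp ((U : ℂ) * Complex.I))⁻¹) / 2) = ((c * Real.cos U : ℝ) : ℂ) := by
  rw [exp_eq_cexp, ← Complex.exp_neg, Complex.ofReal_mul, Complex.ofReal_cos]
  congr 1
  have h := Complex.two_cos (U : ℂ)
  rw [neg_mul] at h
  rw [← h]
  ring

/-- **HOLOMORPHY ON THE ANNULUS** of the toy extension `V ↦ c·(V() + V()⁻¹)∕2` (`V() ≠ 0` there; `differentiableAt_apply`,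
`DifferentiableAt.inv`). [folklore] -/
theorem toy_hol {ϱ : ℝ} (c : ℂ) :
    DifferentiableOn ℂ (fun V : Unit → ℂ => c * ((V () + (V ())⁻¹) / 2))
      {V : Unit → ℂ | ∀ b, Real.exp (-ϱ) < ‖V b‖ ∧ ‖V b‖ < Real.exp ϱ} := by
  intro V hV
  have hne : V () ≠ 0 := fun h0 => by
    have h := (hV ()).1
    rw [h0, norm_zero] at h
    exact (lt_irrefl _ (h.trans (Real.exp_pos _))).elim
  have h1 : DifferentiableAt ℂ (fun W : Unit → ℂ => W ()) V := differentiableAt_apply () V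
  have h2 : DifferentiableAt ℂ (fun W : Unit → ℂ => (W () + (W ())⁻¹) * (2 : ℂ)⁻¹) V :=
    (h1.add (h1.inv hne)).mul_const _
  have h3 : DifferentiableAt ℂ (fun W : Unit → ℂ => c * ((W () + (W ())⁻¹) / 2)) V := by
    simp only [div_eq_mul_inv]
    exact h2.const_mul _
  exact h3.differentiableWithinAt

/-- **THE BOUND `E₀` ON THE ANNULUS** in the letters the tube-line theorems ask (`toyCarriers`: `d ≡ 0`; `κ = 0`):
`‖E₀e^{−ϱ}(V + V⁻¹)∕2‖ ≤ E₀e^{−ϱ}e^{ϱ} = E₀`. [folklore] -/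
theorem toy_bd {ϱ E₀ : ℝ} (hE₀ : 0 ≤ E₀) (X : ℕ) {V : Unit → ℂ}
    (hV : ∀ b, Real.exp (-ϱ) < ‖V b‖ ∧ ‖V b‖ < Real.exp ϱ) :
    ‖((E₀ * Real.exp (-ϱ) : ℝ) : ℂ) * ((V () + (V ())⁻¹) / 2)‖ ≤ E₀ * Real.exp (-(0 * toyCarriers.d X)) := by
  have hc : 0 ≤ E₀ * Real.exp (-ϱ) := mul_nonneg hE₀ (Real.exp_pos _).le
  rw [zero_mul, neg_zero, Real.exp_zero, mul_one]
  calc ‖((E₀ * Real.exp (-ϱ) : ℝ) : ℂ) * ((V () + (V ())⁻¹) / 2)‖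
      ≤ E₀ * Real.exp (-ϱ) * Real.exp ϱ := toy_bound hc (hV ()).1 (hV ()).2
    _ = E₀ := by rw [mul_assoc, ← Real.exp_add, neg_add_cancel, Real.exp_zero, mul_one]

/-- **PAIR DISCS FOR THE U(1) TOY THROUGH THE TUBE LINE** (non-vacuity of the binder set of
`N19LipBracketTubeLine.pairDisc_of_tubeLine_norm`).  On `toyCarriers` (domains `ℕ`, tree length `0`, backgrounds `ℝ`,
gauge `|U − U′|`), window `univ`, `κ = 0`, radius `ϱ > 0`: the chart `emb U = exp(iU) : Unit → ℂ`, the annulus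
`e^{−ϱ} < |V| < e^{ϱ}` as the space and the extension `Ecx V = E₀e^{−ϱ}(V + V⁻¹)∕2` satisfy tube ⊆ space, holomorphy on the
space, the bound `E₀` there, real agreement with this seat's g2 toy functional `E₀e^{−ϱ}cos U`, and the reach convention —
so every pair of backgrounds closer than `ϱ` gets its pair disc (it is `z ↦ E₀e^{−ϱ}cos(U + z·(U′−U)∕|U′−U|)`, g2's toy disc,
now PRODUCED by the tube line).  `N19LipBracketTube.lipBackground_of_pairDisc` on this and `toy_decayBound_of_tubeLine`
below returns the conclusion of `N19LipBracketTubeWitness.toy_pairDisc` (landed; not restated here). [folklore] -/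
theorem toy_pairDiscs_of_tubeLine {ϱ E₀ : ℝ} (hϱ : 0 < ϱ) (hE₀ : 0 ≤ E₀) :
    ∀ s ∈ (Set.univ : Set (ℕ → ℝ)), ∀ (X : ℕ) (U U' : ℝ), |U - U'| < ϱ →
      ∃ f : ℂ → ℂ, DifferentiableOn ℂ f (ball (0 : ℂ) ϱ) ∧
        f 0 = ((E₀ * Real.exp (-ϱ) * Real.cos U : ℝ) : ℂ) ∧
        f ((|U - U'| : ℝ) : ℂ) = ((E₀ * Real.exp (-ϱ) * Real.cos U' : ℝ) : ℂ) ∧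
        ∀ z ∈ ball (0 : ℂ) ϱ, ‖f z‖ ≤ E₀ := by
  intro s hs X U U' hgap
  obtain ⟨f, hf, hf0, hf1, hfb⟩ := N19LipBracketTubeLine.pairDisc_of_tubeLine_norm (C := toyCarriers)
    (EA := fun _ (U : ℝ) _ => E₀ * Real.exp (-ϱ) * Real.cos U) (W := Set.univ) (κ := 0) (E₀ := E₀)
    (ϱ := fun _ _ => ϱ) (fun (U : ℝ) (_ : Unit) => exp ((U : ℂ) * Complex.I))
    (fun _ _ => {V : Unit → ℂ | ∀ b, Real.exp (-ϱ) < ‖V b‖ ∧ ‖V b‖ < Real.exp ϱ})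
    (fun _ _ V => ((E₀ * Real.exp (-ϱ) : ℝ) : ℂ) * ((V () + (V ())⁻¹) / 2))
    (fun _ _ _ U K hK => fun b => toy_tube_mem_annulus U ((pi_norm_lt_iff hϱ).2 hK) b)
    (fun _ _ _ => toy_hol _)
    (fun _ _ X V hV => toy_bd hE₀ X hV)
    (fun _ _ _ U => toy_real _ U)
    (fun _ _ _ U U' _ => by
      obtain ⟨K, hK, e⟩ := toy_emb_reach U U'
      exact ⟨K, fun b => (norm_le_pi_norm K b).trans hK, e⟩) s hs X U U' hgap
  refine ⟨f, hf, hf0, hf1, fun z hz => ?_⟩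
  have h := hfb z hz
  rwa [show (-(0 * Carriers.d toyCarriers X) : ℝ) = 0 by simp, Real.exp_zero, mul_one] at h

/-- **THE REAL BOUND FOR THE U(1) TOY THROUGH THE TUBE LINE**: `DecayBound` with `E₀` for g2's toy functional, from
`N19LipBracketTubeLine.decayBound_of_tubeLine` (sup-norm size; the background `exp(iU) = exp(0)·exp(iU)` lies in its own
tube ⊆ annulus). [folklore] -/
theorem toy_decayBound_of_tubeLine {ϱ E₀ : ℝ} (hϱ : 0 < ϱ) (hE₀ : 0 ≤ E₀) :
    T4OutputRate.DecayBound (C := toyCarriers) (fun _ (U : ℝ) _ => E₀ * Real.exp (-ϱ) * Real.cos U) Set.univ E₀ 0 := by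
  exact N19LipBracketTubeLine.decayBound_of_tubeLine (C := toyCarriers) (ϱ := fun _ _ => ϱ)
    (fun (U : ℝ) (_ : Unit) => exp ((U : ℂ) * Complex.I)) (fun _ K => ‖K‖)
    (fun _ _ => {V : Unit → ℂ | ∀ b, Real.exp (-ϱ) < ‖V b‖ ∧ ‖V b‖ < Real.exp ϱ})
    (fun _ _ V => ((E₀ * Real.exp (-ϱ) : ℝ) : ℂ) * ((V () + (V ())⁻¹) / 2))
    (fun _ _ _ => hϱ) (fun _ K c => (norm_smul c K).le)
    (fun _ _ _ U K hK => fun b => toy_tube_mem_annulus U hK b)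
    (fun _ _ X V hV => toy_bd hE₀ X hV)
    (fun _ _ _ U => toy_real _ U)

end Summit.QuantumFields.YangMills.BalabanUVNodes.N19LipBracketTubeLineWitness
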